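import Summits.CriticalPhenomena.PercolationContinuityZ3.Theorems.PercNearOneGluingNoHeavyLowerTailSahiThreeCopyBernstein
import Summits.CriticalPhenomena.PercolationContinuityZ3.Theorems.PercNearOneGluingNoHeavyLowerTailSahiThreeCopyCylinder

/-!
# `NoHeavyLowerTail` (crux stmt-CriticalPhenomena-4575), Sahi programme: **law-level corollaries of the coefficientwise three-copy
# theorems** — `E₃ ≥ 0` under EVERY product measure on `{0,1}^d` for (i) one cumulation slot and two arbitrary monotone slots,
# (ii) two nested slots, obtained by summing the nonnegative tensor-Bernstein coefficients

Support file (Sahi cell, seat `prim-sahi-p1`, generation 53; `--supports stmt-CriticalPhenomena-4575`).  Pure proofs; no `sorry`, standard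
axioms.  The coefficientwise statements are `tc_cprod_nonneg` (…Cylinder) and `tc_nonneg_of_mul_eq` (…Nested); the bridge is
`sahiE_three_coin_nonneg_of_tc` (…Bernstein).  The law-level facts are in the spirit of the tree's `sahiE3_cylinder_nonneg`,
`latticeE3_nonneg_of_principal`, `sahiE3_nonneg_of_subset` (events) and of [Sahi2008, Thm. 2] (all slots cumulations); here the free
slots are arbitrary nonnegative monotone FUNCTIONS and the route is the Bernstein expansion. [this work]
-/

namespace Summit.CriticalPhenomena.PercolationContinuityZ3.Theorems.SahiThreeCopy

open Finset Function Literature.Combinatorics.Sahi2008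
open scoped BigOperators

noncomputable section

variable {d : ℕ}

/-- **One cumulation slot (law level)**: for every coin weight `q ∈ [0,1]^d`, every coordinate product `a = Π_i(α_i + β_i x_i)`
(`α, β ≥ 0`; e.g. the indicator of a principal up-set) and all nonnegative monotone `g, h`: `0 ≤ E₃^{coin q}(a, g, h)`. [this work] -/
theorem sahiE_three_coin_cprod_nonneg {q : Fin d → ℝ} (hq : ∀ i, 0 ≤ q i ∧ q i ≤ 1) {α β : Fin d → ℝ} (hα : ∀ i, 0 ≤ α i)
    (hβ : ∀ i, 0 ≤ β i) {g h : Pt d → ℝ} (hg : ∀ x, 0 ≤ g x) (hgm : Monotone g) (hh : ∀ x, 0 ≤ h x) (hhm : Monotone h) :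
    0 ≤ sahiE (coinWeight q) 3 ![cprod α β, g, h] :=
  sahiE_three_coin_nonneg_of_tc hq fun b => tc_cprod_nonneg b hα hβ hg hgm hh hhm

/-- The cumulation slot in the middle: `0 ≤ E₃^{coin q}(g, a, h)`. [this work] -/
theorem sahiE_three_coin_cprod_mid_nonneg {q : Fin d → ℝ} (hq : ∀ i, 0 ≤ q i ∧ q i ≤ 1) {α β : Fin d → ℝ} (hα : ∀ i, 0 ≤ α i)
    (hβ : ∀ i, 0 ≤ β i) {g h : Pt d → ℝ} (hg : ∀ x, 0 ≤ g x) (hgm : Monotone g) (hh : ∀ x, 0 ≤ h x) (hhm : Monotone h) :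
    0 ≤ sahiE (coinWeight q) 3 ![g, cprod α β, h] :=
  sahiE_three_coin_nonneg_of_tc hq fun b => tc_cprod_nonneg_mid b hα hβ hg hgm hh hhm

/-- **A principal up-set and two arbitrary up-sets (law level, events)**: `0 ≤ E₃^{coin q}(1_{↑m}, 1_B, 1_C)`. [this work] -/
theorem sahiE_three_coin_principal_nonneg {q : Fin d → ℝ} (hq : ∀ i, 0 ≤ q i ∧ q i ≤ 1) (m : Pt d) {B C : Finset (Pt d)}
    (hB : IsUpperSet (B : Set (Pt d))) (hC : IsUpperSet (C : Set (Pt d))) :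
    0 ≤ sahiE (coinWeight q) 3 ![setInd (univ.filter fun x : Pt d => ∀ i, m i = true → x i = true), setInd B, setInd C] :=
  sahiE_three_coin_nonneg_of_tc hq fun b => tc_setInd_principal_nonneg b m hB hC

/-- **Two nested slots (law level)**: if `g·h = g` and `h ≤ 1` (e.g. indicators of up-sets `B ⊆ C`) then `0 ≤ E₃^{coin q}(f, g, h)` for
every nonnegative monotone `f` and every `q ∈ [0,1]^d`. [this work] -/
theorem sahiE_three_coin_nested_nonneg {q : Fin d → ℝ} (hq : ∀ i, 0 ≤ q i ∧ q i ≤ 1) {f g h : Pt d → ℝ} (hf : ∀ x, 0 ≤ f x)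
    (hfm : Monotone f) (hg : ∀ x, 0 ≤ g x) (hgm : Monotone g) (hh : ∀ x, 0 ≤ h x) (hhm : Monotone h) (hgh : g * h = g)
    (hh1 : ∀ x, h x ≤ 1) : 0 ≤ sahiE (coinWeight q) 3 ![f, g, h] :=
  sahiE_three_coin_nonneg_of_tc hq fun b => tc_nonneg_of_mul_eq b hf hfm hg hgm hh hhm hgh hh1

/-- Events form of the nested case: `0 ≤ E₃^{coin q}(1_A, 1_B, 1_C)` for up-sets with `B ⊆ C`. [this work] -/
theorem sahiE_three_coin_subset_nonneg {q : Fin d → ℝ} (hq : ∀ i, 0 ≤ q i ∧ q i ≤ 1) {A B C : Finset (Pt d)}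
    (hA : IsUpperSet (A : Set (Pt d))) (hB : IsUpperSet (B : Set (Pt d))) (hC : IsUpperSet (C : Set (Pt d))) (hBC : B ⊆ C) :
    0 ≤ sahiE (coinWeight q) 3 ![setInd A, setInd B, setInd C] :=
  sahiE_three_coin_nonneg_of_tc hq fun b => tc_setInd_nonneg_of_subset₂₃ b hA hB hC hBC


/-! ### Sahi's cumulation cone in one slot (appended, p1 gen53) -/

/-- `c_b` of a finite linear combination in the first slot. [this work] -/
theorem tc_finset_sum_smul_left (b : Fin d → ℕ) (g h : Pt d → ℝ) {ι : Type*} (s : Finset ι) (c : ι → ℝ)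
    (F : ι → Pt d → ℝ) : tc b (∑ i ∈ s, c i • F i) g h = ∑ i ∈ s, c i * tc b (F i) g h := by
  classical
  induction s using Finset.induction_on with
  | empty => simp [tc_zero_left]
  | insert i s hi ih => rw [sum_insert hi, sum_insert hi, tc_add_left, tc_smul_left, ih]

/-- The CUMULATION with nonnegative coefficients `c`: `x ↦ Σ_m c(m)·1_{m ≤ x}` — Sahi's cone `𝒞[X] = {F⁺ : F ≥ 0}`,
`F⁺(T) = Σ_{S ⊆ T} F(S)` [Sahi2008, eq. (1)], written on the cube `{0,1}^d` (the principal up-set `↑m` is the cylinder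
`[x_i = 1 ∀ i ∈ m]`). [this work; cite: Sahi2008, eq. (1) (p. 210)] -/
def cumul (c : Pt d → ℝ) : Pt d → ℝ :=
  ∑ m : Pt d, c m • setInd (univ.filter fun x : Pt d => ∀ i, m i = true → x i = true)

/-- **3C-SAHI with one slot in Sahi's cumulation cone, coefficientwise**: for `c ≥ 0` and arbitrary nonnegative monotone `g, h`,
`0 ≤ c_b(cumul c, g, h)` at every profile (linearity over `tc_cprod_nonneg`).  At law level [Sahi2008, Thm. 2] needs ALL slots in
the cone; here one cumulation slot suffices, the other two are arbitrary, and the statement is per tensor-Bernstein coefficient. [this work] -/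
theorem tc_cumul_nonneg (b : Fin d → ℕ) {c : Pt d → ℝ} (hc : ∀ m, 0 ≤ c m) {g h : Pt d → ℝ} (hg : ∀ x, 0 ≤ g x)
    (hgm : Monotone g) (hh : ∀ x, 0 ≤ h x) (hhm : Monotone h) : 0 ≤ tc b (cumul c) g h := by
  unfold cumul
  rw [tc_finset_sum_smul_left]
  refine sum_nonneg fun m _ => mul_nonneg (hc m) ?_
  rw [← cprod_principal]
  exact tc_cprod_nonneg b (fun i => by split_ifs <;> norm_num) (fun i => by split_ifs <;> norm_num) hg hgm hh hhm

/-- Law level: `0 ≤ E₃^{coin q}(cumul c, g, h)` for every coin weight `q ∈ [0,1]^d`. [this work; cf. Sahi2008, Thm. 2] -/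
theorem sahiE_three_coin_cumul_nonneg {q : Fin d → ℝ} (hq : ∀ i, 0 ≤ q i ∧ q i ≤ 1) {c : Pt d → ℝ} (hc : ∀ m, 0 ≤ c m)
    {g h : Pt d → ℝ} (hg : ∀ x, 0 ≤ g x) (hgm : Monotone g) (hh : ∀ x, 0 ≤ h x) (hhm : Monotone h) :
    0 ≤ sahiE (coinWeight q) 3 ![cumul c, g, h] :=
  sahiE_three_coin_nonneg_of_tc hq fun b => tc_cumul_nonneg b hc hg hgm hh hhm

end

end Summit.CriticalPhenomena.PercolationContinuityZ3.Theorems.SahiThreeCopy
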